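import Summits.CriticalPhenomena.PercolationContinuityZ3.Theorems.PercNearOneGluingAdditiveGluingKnLemma3Mixed
import HarnessLib

/-! # Crux `PercNearOneGluing.AdditiveGluing` (stmt-CriticalPhenomena-4576) — QUANTITATIVE form of Kozma–Nitzan's Lemma 3 for
# mixed-monotone conditioning events (seat (b) V⁺-form, depth prover `png-dp-vplus`, gen 5)

Support file (`--supports stmt-CriticalPhenomena-4576`); no definitions, no named facts.  Companion of
`…AdditiveGluingKnLemma3Mixed.lean` (`knLemma3Mixed`: if `P(a₁↔b) ≤ P(a₂↔b) + d` and `Q` is increasing in `C_{a₂}` and decreasing in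
`C_{a₁}`, then `P({a₁↔b} ∩ Q) ≤ P({a₂↔b} ∩ Q) + d`).

The two van den Berg–Häggström–Kahn bounds used in that proof (`knLemma3Mixed_sSide/_tSide`, BHK 2006 Thm 1.5 on `D = {a₁ ↮ a₂}`),
`μ(D)·μ(D ∩ Q ∩ {a₁↔b}) ≤ μ(D ∩ Q)·μ(D ∩ {a₁↔b})` and `μ(D ∩ Q)·μ(D ∩ {a₂↔b}) ≤ μ(D)·μ(D ∩ Q ∩ {a₂↔b})`, combine WITHOUT any hypothesis
on the order of `a₁, a₂` into the two-sided linear transfer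
  `μ(D) · [μ({a₂↔b} ∩ Q) − μ({a₁↔b} ∩ Q)]  ≥  μ(D ∩ Q) · [μ(a₂↔b) − μ(a₁↔b)]`          (`knLemma3Mixed_quant`)
(on `Dᶜ = {a₁ ↔ a₂}` the events `{a₁↔b}`, `{a₂↔b}` coincide, so both brackets live on `D`).  So a restricted exchange inherits the FULL
two-point gap with the factor `P(Q | a₁ ↮ a₂) ∈ [0,1]` — for either sign of the gap: a slack `μ(a₂↔b) − μ(a₁↔b) = s > 0` yields
`μ({a₂↔b} ∩ Q) − μ({a₁↔b} ∩ Q) ≥ s·P(Q | D)`, and a defect `−δ` costs at most `δ·P(Q | D) ≤ δ` (KN's printed form).  This is the transfer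
used termwise in the quantitative peel / first-touched-contact decompositions of the finger multi-edge Lemma 3 (depth-prover memo MEMO-gen5 §8).
[cite: KozmaNitzan2024, Lemma 3 (pp. 6–7)] [cite: VandenbergHaggstromKahn2005, Thm. 1.5 (p. 7)]
-/

namespace Summit.CriticalPhenomena.PercolationContinuityZ3.Theorems

open MeasureTheory Set
open Literature.Probability.LatticeModels (prodBernoulli)
open Literature.Probability.Percolation (BondConfig openConn openGraph openEdgeCluster)

noncomputable section
open Classical

section KnLemma3MixedQuant

variable {n : ℕ}

/-- **Quantitative mixed Lemma 3.**  For `Q` increasing in `C_{a₂}` and decreasing in `C_{a₁}` (as a function of the pair of open edge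
clusters) and `D = {a₁ ↮ a₂}`:  `μ(D) · (μ({a₂↔b} ∩ Q) − μ({a₁↔b} ∩ Q)) ≥ μ(D ∩ Q) · (μ(a₂↔b) − μ(a₁↔b))`, whatever the sign of the
two-point gap. [cite: KozmaNitzan2024, Lemma 3 (pp. 6–7)] [cite: VandenbergHaggstromKahn2005, Thm. 1.5 (p. 7)] -/
theorem knLemma3Mixed_quant (w : Sym2 (Fin n) → unitInterval) (a₁ a₂ b : Fin n) (Q : Set (BondConfig (Fin n)))
    (hQ : ∀ ω ω' : BondConfig (Fin n), ω ∈ Q → openEdgeCluster ω a₂ ⊆ openEdgeCluster ω' a₂ →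
      openEdgeCluster ω' a₁ ⊆ openEdgeCluster ω a₁ → ω' ∈ Q) :
    (prodBernoulli w).real ((openConn a₁ a₂)ᶜ ∩ Q) *
        ((prodBernoulli w).real (openConn a₂ b) - (prodBernoulli w).real (openConn a₁ b)) ≤
      (prodBernoulli w).real ((openConn a₁ a₂)ᶜ : Set (BondConfig (Fin n))) *
        ((prodBernoulli w).real (openConn a₂ b ∩ Q) - (prodBernoulli w).real (openConn a₁ b ∩ Q)) := by
  rcases eq_or_ne a₁ a₂ with h12 | h12
  · subst h12
    simp
  have hDm : MeasurableSet ((openConn a₁ a₂)ᶜ : Set (BondConfig (Fin n))) := MeasurableSet.of_discrete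
  -- on `{a₁ ↔ a₂}` the events `{a₁ ↔ b}` and `{a₂ ↔ b}` coincide
  have hagree : ∀ E : Set (BondConfig (Fin n)),
      (openConn a₁ b ∩ E) \ (openConn a₁ a₂)ᶜ = (openConn a₂ b ∩ E) \ (openConn a₁ a₂)ᶜ := by
    intro E
    ext ω
    simp only [Set.mem_sdiff, Set.mem_inter_iff, Set.mem_compl_iff, not_not]
    constructor
    · rintro ⟨⟨h1, hE⟩, h2⟩
      exact ⟨⟨SimpleGraph.Reachable.trans (SimpleGraph.Reachable.symm h2) h1, hE⟩, h2⟩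
    · rintro ⟨⟨h1, hE⟩, h2⟩
      exact ⟨⟨SimpleGraph.Reachable.trans h2 h1, hE⟩, h2⟩
  have hs1 := measureReal_inter_add_sdiff (μ := prodBernoulli w) (s := openConn a₁ b) hDm
  have hs2 := measureReal_inter_add_sdiff (μ := prodBernoulli w) (s := openConn a₂ b) hDm
  have hs1Q := measureReal_inter_add_sdiff (μ := prodBernoulli w) (s := openConn a₁ b ∩ Q) hDm
  have hs2Q := measureReal_inter_add_sdiff (μ := prodBernoulli w) (s := openConn a₂ b ∩ Q) hDm
  have he : (prodBernoulli w).real (openConn a₁ b \ (openConn a₁ a₂)ᶜ) =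
      (prodBernoulli w).real (openConn a₂ b \ (openConn a₁ a₂)ᶜ) := by
    have h := hagree Set.univ
    simp only [Set.inter_univ] at h
    rw [h]
  have heQ : (prodBernoulli w).real ((openConn a₁ b ∩ Q) \ (openConn a₁ a₂)ᶜ) =
      (prodBernoulli w).real ((openConn a₂ b ∩ Q) \ (openConn a₁ a₂)ᶜ) := by
    rw [hagree Q]
  rw [Set.inter_comm (openConn a₁ b) (openConn a₁ a₂)ᶜ] at hs1
  rw [Set.inter_comm (openConn a₂ b) (openConn a₁ a₂)ᶜ] at hs2
  rw [Set.inter_comm (openConn a₁ b ∩ Q) (openConn a₁ a₂)ᶜ] at hs1Q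
  rw [Set.inter_comm (openConn a₂ b ∩ Q) (openConn a₁ a₂)ᶜ] at hs2Q
  -- the two BHK Thm 1.5 bounds (`s = a₂`, `t = a₁`), rewritten to `D = (openConn a₁ a₂)ᶜ`
  have hcomm : (openConn a₂ a₁ : Set (BondConfig (Fin n))) = openConn a₁ a₂ :=
    Set.ext fun _ => ⟨fun h => SimpleGraph.Reachable.symm h, fun h => SimpleGraph.Reachable.symm h⟩
  have hI := knLemma3Mixed_tSide w a₂ a₁ b Q hQ h12.symm
  have hII := knLemma3Mixed_sSide w a₂ a₁ b Q hQ h12.symm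
  rw [hcomm] at hI hII
  rw [Set.inter_comm Q (openConn a₁ b)] at hI
  rw [Set.inter_comm Q (openConn a₂ b)] at hII
  -- names: m = μ(D), q = μ(D ∩ Q), x_i = μ(D ∩ {a_i b}), y_i = μ(D ∩ ({a_i b} ∩ Q)); c, cQ the common parts on Dᶜ
  set m := (prodBernoulli w).real ((openConn a₁ a₂)ᶜ : Set (BondConfig (Fin n))) with hm
  set q := (prodBernoulli w).real ((openConn a₁ a₂)ᶜ ∩ Q) with hq
  set x₁ := (prodBernoulli w).real ((openConn a₁ a₂)ᶜ ∩ openConn a₁ b) with hx₁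
  set x₂ := (prodBernoulli w).real ((openConn a₁ a₂)ᶜ ∩ openConn a₂ b) with hx₂
  set y₁ := (prodBernoulli w).real ((openConn a₁ a₂)ᶜ ∩ (openConn a₁ b ∩ Q)) with hy₁
  set y₂ := (prodBernoulli w).real ((openConn a₁ a₂)ᶜ ∩ (openConn a₂ b ∩ Q)) with hy₂
  set c := (prodBernoulli w).real (openConn a₂ b \ (openConn a₁ a₂)ᶜ) with hc
  set cQ := (prodBernoulli w).real ((openConn a₂ b ∩ Q) \ (openConn a₁ a₂)ᶜ) with hcQ
  -- totals in terms of the pieces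
  have t1 : (prodBernoulli w).real (openConn a₁ b) = x₁ + c := by rw [← hs1, he]
  have t2 : (prodBernoulli w).real (openConn a₂ b) = x₂ + c := by rw [← hs2]
  have t1Q : (prodBernoulli w).real (openConn a₁ b ∩ Q) = y₁ + cQ := by rw [← hs1Q, heQ]
  have t2Q : (prodBernoulli w).real (openConn a₂ b ∩ Q) = y₂ + cQ := by rw [← hs2Q]
  rw [t1, t2, t1Q, t2Q]
  have hI' : m * y₁ ≤ q * x₁ := by simpa only [mul_comm] using hI
  have hII' : q * x₂ ≤ m * y₂ := by simpa only [mul_comm] using hII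
  have key : q * (x₂ + c - (x₁ + c)) = q * x₂ - q * x₁ := by ring
  have key' : m * (y₂ + cQ - (y₁ + cQ)) = m * y₂ - m * y₁ := by ring
  rw [key, key']
  linarith

/-- **Corollary (positive transfer).**  If `μ(a₁↔b) + s ≤ μ(a₂↔b)` then for every mixed-monotone `Q`,
`μ(D ∩ Q) · s ≤ μ(D) · (μ({a₂↔b} ∩ Q) − μ({a₁↔b} ∩ Q))` (`D = {a₁ ↮ a₂}`): the restricted exchange inherits the gap `s` with the factor
`P(Q ∩ D)` (and in particular is non-negative when `s ≥ 0`). [cite: KozmaNitzan2024, Lemma 3 (pp. 6–7)] -/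
theorem knLemma3Mixed_transfer (w : Sym2 (Fin n) → unitInterval) (a₁ a₂ b : Fin n) (Q : Set (BondConfig (Fin n))) (s : ℝ)
    (hQ : ∀ ω ω' : BondConfig (Fin n), ω ∈ Q → openEdgeCluster ω a₂ ⊆ openEdgeCluster ω' a₂ →
      openEdgeCluster ω' a₁ ⊆ openEdgeCluster ω a₁ → ω' ∈ Q)
    (hs : (prodBernoulli w).real (openConn a₁ b) + s ≤ (prodBernoulli w).real (openConn a₂ b)) :
    (prodBernoulli w).real ((openConn a₁ a₂)ᶜ ∩ Q) * s ≤
      (prodBernoulli w).real ((openConn a₁ a₂)ᶜ : Set (BondConfig (Fin n))) *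
        ((prodBernoulli w).real (openConn a₂ b ∩ Q) - (prodBernoulli w).real (openConn a₁ b ∩ Q)) := by
  have h := knLemma3Mixed_quant w a₁ a₂ b Q hQ
  have hq0 : 0 ≤ (prodBernoulli w).real ((openConn a₁ a₂)ᶜ ∩ Q) := measureReal_nonneg
  have h1 : (prodBernoulli w).real ((openConn a₁ a₂)ᶜ ∩ Q) * s ≤
      (prodBernoulli w).real ((openConn a₁ a₂)ᶜ ∩ Q) *
        ((prodBernoulli w).real (openConn a₂ b) - (prodBernoulli w).real (openConn a₁ b)) :=
    mul_le_mul_of_nonneg_left (by linarith) hq0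
  exact h1.trans h

end KnLemma3MixedQuant

end

end Summit.CriticalPhenomena.PercolationContinuityZ3.Theorems
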